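import Summits.NavierStokesRegularity.NavierStokesRegularity.Theorems.BlowupIsLocallyDriven.Negative.BlowupIsLocallyDrivenFalseOfRigidFarStrainBlowup

/-!
# Crux `CoreLogGas.BlowupIsLocallyDriven` (stmt-NavierStokesRegularity-11291): tightness of the RE-TYPED crux — the
# scale-free modulus `B_rate2` (and its `ξ`-form) fails exactly for blow-ups whose far-strain fraction profile is not `O(M⁻²)`

`--supports stmt-NavierStokesRegularity-11291` (lead `prover-line-stmt-NavierStokesRegularity-11291-c5-0`, 2026-08-17).

Lead c2's negative lemma (`Negative.BlowupIsLocallyDriven_false_of_RigidFarStrainBlowup`, p154961) showed that B AS FILED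
dies on any rigidly far-strained collapse whatever its shape, which is the refuters' misstatement finding. For the
re-typed crux `B_rate2` (text of `Cruxes/BlowupIsLocallyDriven/RestatementC4.lean`, = conclusion of `Rate.bRate_of_shellRate`)
the same Beale–Kato–Majda mechanism (`Negative.hasSmoothExtensionPast_of_iSup_curl_le`) gives the sharp analogue, which is
what the crux's disprover must exhibit against the re-typing and what a proof must exclude:

* `bRate_false_of_superQuadraticRigidBlowup` (registered stub) — if ONE maximal finite-energy classical solution from Clay
  data has a SUPER-QUADRATIC rigid far-strain profile — for every `C ≥ 0` some `M ≥ 1` and level `c > C/M²` such that from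
  some `t₁ < T` on every time carries an admissible triple and a unit direction with defect `≥ c·Ω(t)` at scale `Mρ` —
  then `B_rate2` is false (on `[max t₀ t₁, T)` one would get `(c − C/M²)·Ω ≤ g ∈ L¹`, hence continuation past `T`).
  A collapsing SHEET (fraction `(2/π)/M`, so `M²·fraction → ∞`) is such a profile — the intended failure; rigid tubes /
  pairs (`∼ M⁻⁴`) and rings / blobs (`∼ M⁻²`) are not.
* `bRateXi_false_of_superQuadraticRigidBlowupXi` (registered stub) — the same for the stretching-direction form
  `B_rate2_xi` (defect paired with `w = ω(t,x)`, level `c·Ω(t)·‖w‖²`, `w ≠ 0`).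

Neither hypothesis is constructible in the tree (an inhabitant is a finite-time NS singularity from Schwartz data); the
theorems are implications between explicit texts and change no verdict.
-/

noncomputable section

open Set MeasureTheory Filter Topology Metric

-- justification: the namespace is fixed by the crux protocol (sibling files of this crux use `…Theorems.BlowupIsLocallyDriven.*`).
set_option linter.dupNamespace false

namespace Summit.NavierStokesRegularity.NavierStokesRegularity.Theorems.BlowupIsLocallyDriven.Negative

open Literature.Analysis.FluidPDE

/-- **`B_rate2` is false on any super-quadratically far-strained blow-up (registered stub
`bRate_false_of_superQuadraticRigidBlowup`).** See the module docstring; Beale–Kato–Majda with the integrable majorant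
`g/(c − C/M²)` on a final interval (`hasSmoothExtensionPast_of_iSup_curl_le`). [cite: BealeKatoMajda1984, Theorem 1] -/
theorem bRate_false_of_superQuadraticRigidBlowup : (∃ (ν T : ℝ) (u : ℝ → EuclideanSpace ℝ (Fin 3) → EuclideanSpace ℝ (Fin 3)) (p : ℝ → EuclideanSpace ℝ (Fin 3) → ℝ), 0 < ν ∧ 0 < T ∧ Literature.Analysis.FluidPDE.IsMaximalSmoothSolution ν 0 u p T ∧ Literature.Analysis.FluidPDE.IsLerayHopfOn T ν 0 (u 0) u ∧ Literature.Analysis.FluidPDE.HasRapidSpatialDecay (u 0) ∧ ∀ (C : ℝ), 0 ≤ C → ∃ (M : ℝ), 1 ≤ M ∧ ∃ (c : ℝ), C / M ^ 2 < c ∧ ∃ t₁ ∈ Set.Ico 0 T, ∀ t ∈ Set.Ico t₁ T, ∃ (x : EuclideanSpace ℝ (Fin 3)) (ρ : ℝ), 0 < ρ ∧ (⨆ z, ‖Literature.Analysis.FluidPDE.curl (u t) z‖) ≤ 2 * ‖Literature.Analysis.FluidPDE.curl (u t) x‖ ∧ Metric.ball x ρ ⊆ {y | (⨆ z, ‖Literature.Analysis.FluidPDE.curl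 (u t) z‖) ≤ 4 * ‖Literature.Analysis.FluidPDE.curl (u t) y‖} ∧ (∀ (x' : EuclideanSpace ℝ (Fin 3)) (ρ' : ℝ), (⨆ z, ‖Literature.Analysis.FluidPDE.curl (u t) z‖) ≤ 2 * ‖Literature.Analysis.FluidPDE.curl (u t) x'‖ → Metric.ball x' ρ' ⊆ {y | (⨆ z, ‖Literature.Analysis.FluidPDE.curl (u t) z‖) ≤ 4 * ‖Literature.Analysis.FluidPDE.curl (u t) y‖} → ρ' ≤ 2 * ρ) ∧ ∃ e : EuclideanSpace ℝ (Fin 3), ‖e‖ = 1 ∧ c * (⨆ z, ‖Literature.Analysis.FluidPDE.curl (u t) z‖) ≤ |inner ℝ ((fderiv ℝ (u t) x - fderiv ℝ (fun z : EuclideanSpace ℝ (Fin 3) => ∫ y, (4 * Real.pi * ‖z - y‖ ^ 3)⁻¹ • Literature.Analysis.FluidPDE.cross ((Metric.ball x (M * ρ)).indicator (Literature.Analysis.FluidPDE.curl (u t)) y) (z - y)) x) e) e|) → ¬ (∀ (ν T : ℝ), 0 < ν → 0 < T → ∀ (u : ℝ → EuclideanSpace ℝ (Fin 3) → EuclideanSpace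 ℝ (Fin 3)) (p : ℝ → EuclideanSpace ℝ (Fin 3) → ℝ), Literature.Analysis.FluidPDE.IsMaximalSmoothSolution ν 0 u p T → Literature.Analysis.FluidPDE.IsLerayHopfOn T ν 0 (u 0) u → Literature.Analysis.FluidPDE.HasRapidSpatialDecay (u 0) → ∃ (C t₀ : ℝ) (g : ℝ → ℝ), 0 ≤ C ∧ 0 ≤ t₀ ∧ t₀ < T ∧ MeasureTheory.IntegrableOn g (Set.Ico t₀ T) ∧ ∀ (M : ℝ), 1 ≤ M → ∀ t ∈ Set.Ico t₀ T, ∀ (x : EuclideanSpace ℝ (Fin 3)) (ρ : ℝ), 0 < ρ → (⨆ z, ‖Literature.Analysis.FluidPDE.curl (u t) z‖) ≤ 2 * ‖Literature.Analysis.FluidPDE.curl (u t) x‖ → Metric.ball x ρ ⊆ {y | (⨆ z, ‖Literature.Analysis.FluidPDE.curl (u t) z‖) ≤ 4 * ‖Literature.Analysis.FluidPDE.curl (u t) y‖} → (∀ (x' : EuclideanSpace ℝ (Fin 3)) (ρ' : ℝ), (⨆ z, ‖Literature.Analysis.FluidPDE.curl (u t) z‖) ≤ 2 * ‖Literature.Analysis.FluidPDE.curl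 (u t) x'‖ → Metric.ball x' ρ' ⊆ {y | (⨆ z, ‖Literature.Analysis.FluidPDE.curl (u t) z‖) ≤ 4 * ‖Literature.Analysis.FluidPDE.curl (u t) y‖} → ρ' ≤ 2 * ρ) → ∀ e : EuclideanSpace ℝ (Fin 3), ‖e‖ = 1 → |inner ℝ ((fderiv ℝ (u t) x - fderiv ℝ (fun z : EuclideanSpace ℝ (Fin 3) => ∫ y, (4 * Real.pi * ‖z - y‖ ^ 3)⁻¹ • Literature.Analysis.FluidPDE.cross ((Metric.ball x (M * ρ)).indicator (Literature.Analysis.FluidPDE.curl (u t)) y) (z - y)) x) e) e| ≤ C / M ^ 2 * (⨆ z, ‖Literature.Analysis.FluidPDE.curl (u t) z‖) + g t) := by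
  rintro ⟨ν, T, u, p, hν, hT, hmax, hLH, hdec, hrig⟩ hB
  obtain ⟨C, t₀, g, hC, ht₀, ht₀T, hg, hloc⟩ := hB ν T hν hT u p hmax hLH hdec
  obtain ⟨M, hM, c, hcC, t₁, ht₁, hfrac⟩ := hrig C hC
  have hgap : 0 < c - C / M ^ 2 := sub_pos.2 hcC
  -- on `[max t₀ t₁, T)` the vorticity maximum is dominated by `g / (c - C/M²)`
  have ht₂ : max t₀ t₁ ∈ Ico 0 T := ⟨ht₀.trans (le_max_left _ _), max_lt ht₀T ht₁.2⟩
  have hle : ∀ t ∈ Ico (max t₀ t₁) T, (⨆ z, ‖curl (u t) z‖) ≤ g t / (c - C / M ^ 2) := by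
    intro t ht
    obtain ⟨x, ρ, hρ, h1, h2, h3, e, he, hce⟩ := hfrac t ⟨(le_max_right _ _).trans ht.1, ht.2⟩
    have hg_t := hloc M hM t ⟨(le_max_left _ _).trans ht.1, ht.2⟩ x ρ hρ h1 h2 h3 e he
    rw [le_div_iff₀ hgap]
    have := hce.trans hg_t
    nlinarith [this]
  have hgc : IntegrableOn (fun t => g t / (c - C / M ^ 2)) (Ico (max t₀ t₁) T) :=
    (hg.mono_set (Ico_subset_Ico_left (le_max_left _ _))).div_const _
  exact hmax.2 (hasSmoothExtensionPast_of_iSup_curl_le hν hT hmax.1 hLH hdec ht₂ hgc hle)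

/-- **`B_rate2_xi` is false on any super-quadratically far-strained blow-up, stretching-direction form (registered stub
`bRateXi_false_of_superQuadraticRigidBlowupXi`).** Same proof, the level being `c·Ω(t)·‖ω(t,x)‖²` with `ω(t,x) ≠ 0`.
[cite: BealeKatoMajda1984, Theorem 1] -/
theorem bRateXi_false_of_superQuadraticRigidBlowupXi : (∃ (ν T : ℝ) (u : ℝ → EuclideanSpace ℝ (Fin 3) → EuclideanSpace ℝ (Fin 3)) (p : ℝ → EuclideanSpace ℝ (Fin 3) → ℝ), 0 < ν ∧ 0 < T ∧ Literature.Analysis.FluidPDE.IsMaximalSmoothSolution ν 0 u p T ∧ Literature.Analysis.FluidPDE.IsLerayHopfOn T ν 0 (u 0) u ∧ Literature.Analysis.FluidPDE.HasRapidSpatialDecay (u 0) ∧ ∀ (C : ℝ), 0 ≤ C → ∃ (M : ℝ), 1 ≤ M ∧ ∃ (c : ℝ), C / M ^ 2 < c ∧ ∃ t₁ ∈ Set.Ico 0 T, ∀ t ∈ Set.Ico t₁ T, ∃ (x : EuclideanSpace ℝ (Fin 3)) (ρ : ℝ), 0 < ρ ∧ (⨆ z, ‖Literature.Analysis.FluidPDE.curl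 (u t) z‖) ≤ 2 * ‖Literature.Analysis.FluidPDE.curl (u t) x‖ ∧ Metric.ball x ρ ⊆ {y | (⨆ z, ‖Literature.Analysis.FluidPDE.curl (u t) z‖) ≤ 4 * ‖Literature.Analysis.FluidPDE.curl (u t) y‖} ∧ (∀ (x' : EuclideanSpace ℝ (Fin 3)) (ρ' : ℝ), (⨆ z, ‖Literature.Analysis.FluidPDE.curl (u t) z‖) ≤ 2 * ‖Literature.Analysis.FluidPDE.curl (u t) x'‖ → Metric.ball x' ρ' ⊆ {y | (⨆ z, ‖Literature.Analysis.FluidPDE.curl (u t) z‖) ≤ 4 * ‖Literature.Analysis.FluidPDE.curl (u t) y‖} → ρ' ≤ 2 * ρ) ∧ 0 < ‖Literature.Analysis.FluidPDE.curl (u t) x‖ ∧ c * (⨆ z, ‖Literature.Analysis.FluidPDE.curl (u t) z‖) * ‖Literature.Analysis.FluidPDE.curl (u t) x‖ ^ 2 ≤ |inner ℝ ((fderiv ℝ (u t) x - fderiv ℝ (fun z : EuclideanSpace ℝ (Fin 3) => ∫ y, (4 * Real.pi * ‖z - y‖ ^ 3)⁻¹ • Literature.Analysis.FluidPDE.cross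 ((Metric.ball x (M * ρ)).indicator (Literature.Analysis.FluidPDE.curl (u t)) y) (z - y)) x) (Literature.Analysis.FluidPDE.curl (u t) x)) (Literature.Analysis.FluidPDE.curl (u t) x)|) → ¬ (∀ (ν T : ℝ), 0 < ν → 0 < T → ∀ (u : ℝ → EuclideanSpace ℝ (Fin 3) → EuclideanSpace ℝ (Fin 3)) (p : ℝ → EuclideanSpace ℝ (Fin 3) → ℝ), Literature.Analysis.FluidPDE.IsMaximalSmoothSolution ν 0 u p T → Literature.Analysis.FluidPDE.IsLerayHopfOn T ν 0 (u 0) u → Literature.Analysis.FluidPDE.HasRapidSpatialDecay (u 0) → ∃ (C t₀ : ℝ) (g : ℝ → ℝ), 0 ≤ C ∧ 0 ≤ t₀ ∧ t₀ < T ∧ MeasureTheory.IntegrableOn g (Set.Ico t₀ T) ∧ ∀ (M : ℝ), 1 ≤ M → ∀ t ∈ Set.Ico t₀ T, ∀ (x : EuclideanSpace ℝ (Fin 3)) (ρ : ℝ), 0 < ρ → (⨆ z, ‖Literature.Analysis.FluidPDE.curl (u t) z‖) ≤ 2 * ‖Literature.Analysis.FluidPDE.curl (u t) x‖ → Metric.ball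 x ρ ⊆ {y | (⨆ z, ‖Literature.Analysis.FluidPDE.curl (u t) z‖) ≤ 4 * ‖Literature.Analysis.FluidPDE.curl (u t) y‖} → (∀ (x' : EuclideanSpace ℝ (Fin 3)) (ρ' : ℝ), (⨆ z, ‖Literature.Analysis.FluidPDE.curl (u t) z‖) ≤ 2 * ‖Literature.Analysis.FluidPDE.curl (u t) x'‖ → Metric.ball x' ρ' ⊆ {y | (⨆ z, ‖Literature.Analysis.FluidPDE.curl (u t) z‖) ≤ 4 * ‖Literature.Analysis.FluidPDE.curl (u t) y‖} → ρ' ≤ 2 * ρ) → |inner ℝ ((fderiv ℝ (u t) x - fderiv ℝ (fun z : EuclideanSpace ℝ (Fin 3) => ∫ y, (4 * Real.pi * ‖z - y‖ ^ 3)⁻¹ • Literature.Analysis.FluidPDE.cross ((Metric.ball x (M * ρ)).indicator (Literature.Analysis.FluidPDE.curl (u t)) y) (z - y)) x) (Literature.Analysis.FluidPDE.curl (u t) x)) (Literature.Analysis.FluidPDE.curl (u t) x)| ≤ (C / M ^ 2 * (⨆ z, ‖Literature.Analysis.FluidPDE.curl (u t) z‖) + g t) * ‖Literature.Analysis.FluidPDE.curl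 (u t) x‖ ^ 2) := by
  rintro ⟨ν, T, u, p, hν, hT, hmax, hLH, hdec, hrig⟩ hB
  obtain ⟨C, t₀, g, hC, ht₀, ht₀T, hg, hloc⟩ := hB ν T hν hT u p hmax hLH hdec
  obtain ⟨M, hM, c, hcC, t₁, ht₁, hfrac⟩ := hrig C hC
  have hgap : 0 < c - C / M ^ 2 := sub_pos.2 hcC
  have ht₂ : max t₀ t₁ ∈ Ico 0 T := ⟨ht₀.trans (le_max_left _ _), max_lt ht₀T ht₁.2⟩
  have hle : ∀ t ∈ Ico (max t₀ t₁) T, (⨆ z, ‖curl (u t) z‖) ≤ g t / (c - C / M ^ 2) := by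
    intro t ht
    obtain ⟨x, ρ, hρ, h1, h2, h3, hw, hce⟩ := hfrac t ⟨(le_max_right _ _).trans ht.1, ht.2⟩
    have hg_t := hloc M hM t ⟨(le_max_left _ _).trans ht.1, ht.2⟩ x ρ hρ h1 h2 h3
    rw [le_div_iff₀ hgap]
    have hw2 : 0 < ‖curl (u t) x‖ ^ 2 := pow_pos hw 2
    have h := hce.trans hg_t
    -- divide the inequality `c Ω ‖w‖² ≤ (C/M² Ω + g) ‖w‖²` by `‖w‖² > 0`
    have h' : c * (⨆ z, ‖curl (u t) z‖) ≤ C / M ^ 2 * (⨆ z, ‖curl (u t) z‖) + g t := by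
      by_contra hlt
      have hlt' := lt_of_not_ge hlt
      have := mul_lt_mul_of_pos_right hlt' hw2
      linarith
    nlinarith [h']
  have hgc : IntegrableOn (fun t => g t / (c - C / M ^ 2)) (Ico (max t₀ t₁) T) :=
    (hg.mono_set (Ico_subset_Ico_left (le_max_left _ _))).div_const _
  exact hmax.2 (hasSmoothExtensionPast_of_iSup_curl_le hν hT hmax.1 hLH hdec ht₂ hgc hle)

end Summit.NavierStokesRegularity.NavierStokesRegularity.Theorems.BlowupIsLocallyDriven.Negative
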